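import Summits.Schanuel.Schanuel.Theorems.RootDecomp1KSumFormBridge03

/-!
# RootDecomp1KSumFormBridge — lens 1, generation 41 «SUM-FORM BRIDGE»: the NAMED E-side input `SumFormExpPairMeasure` (CONJECTURE / IDEA-NEEDED, Mahler's problem in sum form) ⟹ a.i. (ℓ, e^ℓ) for every real Liouville ℓ ⟹ 33364's named first open cell (ℓ_b, ℓ_b²) — a REDUCTION (K-R27′), no cell credit — EDITION 2 (+ §9 the door (T⁺⁺) as a typed SOCKET) — continuation (RootDecomp1KSumFormBridge04): §7 the one-logarithm variant `SumFormLogMeasure` + §8 the minimal pointwise shape and the graded axis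

(lens-1 g41 `RootDecomp1KSumFormBridge.lean` EDITION 2 [HOME/decomp-schanuel-lens-1/g41/ sha256 f8db09bf…, 1674 l; NODE L1914 / REQUEST L1915 / EDITION 2 NOTE L1923; critic VERDICT L1925 (REDUCTION of record, (ε) booking, no credit, port GO)]; port by census-1 gen 17 as
`RootDecomp1KSumFormBridge01`–`06` — see the PORT NOTE of part 01; `--supports stmt-Schanuel-33364`; a REDUCTION to an OPEN conjecture (K-R27′); rung 0.)
-/

noncomputable section

open Complex Polynomial Filter
open scoped Topology

namespace Summit.Schanuel.Schanuel.Theorems.RootDecomp1KSumFormBridge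

open Summit.Schanuel.Schanuel.Theorems.RootDecomp1KHyper
open Summit.Schanuel.Schanuel.Theorems.RootDecomp1KHyper.HyperCell
open Summit.Schanuel.Schanuel.Theorems.RootDecomp1KGeneric
open Literature.NumberTheory.Transcendental (NesterenkoWaldschmidt1996_thm_1 weilHeight₁)

variable {K : ℕ}

/-- `1 ≤ log x` for `x ≥ 3`. -/
private theorem one_le_log_of_three_le {x : ℝ} (hx : 3 ≤ x) : 1 ≤ Real.log x := by
  rw [Real.le_log_iff_exp_le (by linarith)]
  have := Real.exp_one_lt_d9
  linarith

/-! ## §7  The named input as a measure for ONE LOGARITHM with an algebraic coefficient (a WEAKER typed input that still suffices) -/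

/-- **SUM-FORM measure for the linear form `λ − β` in ONE logarithm `λ` of an algebraic number,
with an ALGEBRAIC coefficient `β`** (bounded degree, the two log-heights entering LINEARLY): for
`‖λ‖ ≤ T`, `λ ≠ 0`, `e^λ = α`, `(α, β)` algebraic with `[ℚ(α, β) : ℚ] ≤ N` and heights `≤ L`:
`|λ − β| ≥ exp(−κ(T, N) · L)`.  This is the `u = λ` slice of `SumFormExpPairMeasure` (so it is
formally WEAKER or equal, `logMeasure_of_sumForm`), and it is the shape of the one-logarithm
problem in print (Waldschmidt, Cetraro LNM 1819 §4.1: Mahler's (4.3) `|e^b − a| ≥ a^{−c log log a}`,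
Conjecture 4.1 `a^{−c}`, Thm 4.2 = NW96 with the product `(log A)(log B)`; «any further improvement
… seems to require a new idea»).  A CONJECTURE typed as a `def`, carried only as a hypothesis. -/
def SumFormLogMeasure : Prop :=
  ∀ (T : ℝ) (N : ℕ), ∃ κ : ℝ, ∀ (lam α β : ℂ) (L : ℝ), ‖lam‖ ≤ T → lam ≠ 0 → cexp lam = α →
    AlgPairData α β N L → Real.exp (-(κ * L)) ≤ ‖lam - β‖

/-- The pair form implies the one-logarithm form (take `u = λ`, so `|e^u − α| = 0`). -/
theorem logMeasure_of_sumForm (hSF : SumFormExpPairMeasure) : SumFormLogMeasure := by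
  intro T N
  obtain ⟨κ, hκ⟩ := hSF T N
  refine ⟨κ, fun lam α β L hT h0 hexp hd => ?_⟩
  have h := hκ lam α β L hT h0 hd
  rwa [hexp, sub_self, norm_zero, zero_add] at h

/-- **Choosing the logarithm.**  If `α` is within `e^{−T}/2` of `e^u` and `‖u‖ ≤ T`, then
`λ := u + log(α e^{−u})` has `e^λ = α`, `‖λ − u‖ ≤ (3/2)·e^T·‖e^u − α‖`, and `λ = 0 → α = 1`. -/
theorem exists_log_near {u α : ℂ} {T : ℝ} (huT : ‖u‖ ≤ T)
    (hα : ‖cexp u - α‖ ≤ Real.exp (-T) / 2) :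
    ∃ lam : ℂ, cexp lam = α ∧ ‖lam - u‖ ≤ 3 / 2 * Real.exp T * ‖cexp u - α‖ ∧ (lam = 0 → α = 1) := by
  set w : ℂ := α * cexp (-u) - 1 with hw
  have hexpnu : ‖cexp (-u)‖ ≤ Real.exp T := by
    rw [Complex.norm_exp]
    exact Real.exp_le_exp.mpr ((Complex.re_le_norm _).trans (by rwa [norm_neg]))
  have hone : cexp u * cexp (-u) = 1 := by
    rw [← Complex.exp_add, add_neg_cancel, Complex.exp_zero]
  have hw_eq : w = (α - cexp u) * cexp (-u) := by
    rw [hw]; linear_combination hone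
  have hw_norm : ‖w‖ ≤ Real.exp T * ‖cexp u - α‖ := by
    rw [hw_eq, norm_mul, norm_sub_rev, mul_comm]
    exact mul_le_mul_of_nonneg_right hexpnu (norm_nonneg _)
  have hw_half : ‖w‖ ≤ 1 / 2 := by
    have hT0 : 0 < Real.exp T := Real.exp_pos T
    have hprod : Real.exp T * Real.exp (-T) = 1 := by
      rw [← Real.exp_add, add_neg_cancel, Real.exp_zero]
    calc ‖w‖ ≤ Real.exp T * ‖cexp u - α‖ := hw_norm
      _ ≤ Real.exp T * (Real.exp (-T) / 2) := mul_le_mul_of_nonneg_left hα hT0.le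
      _ = 1 / 2 := by linear_combination (1 / 2 : ℝ) * hprod
  have h1w : 1 + w ≠ 0 := by
    intro h0
    have h1 : w = -1 := by linear_combination h0
    have : ‖w‖ = 1 := by rw [h1, norm_neg, norm_one]
    linarith
  have key : cexp (u + Complex.log (1 + w)) = α := by
    rw [Complex.exp_add, Complex.exp_log h1w, hw]
    linear_combination α * hone
  refine ⟨u + Complex.log (1 + w), key, ?_, fun h0 => by rw [← key, h0, Complex.exp_zero]⟩
  rw [add_sub_cancel_left]
  calc ‖Complex.log (1 + w)‖ ≤ 3 / 2 * ‖w‖ := Complex.norm_log_one_add_half_le_self hw_half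
    _ ≤ 3 / 2 * (Real.exp T * ‖cexp u - α‖) := by gcongr
    _ = 3 / 2 * Real.exp T * ‖cexp u - α‖ := by ring

/-- `exp(−1) ≤ 1/2`. -/
private theorem exp_neg_one_le_half : Real.exp (-1 : ℝ) ≤ 1 / 2 := by
  have h3 : (2 : ℝ) ≤ Real.exp 1 := by linarith [Real.exp_one_gt_d9]
  have hprod : Real.exp (-1 : ℝ) * Real.exp 1 = 1 := by rw [← Real.exp_add]; norm_num
  nlinarith [Real.exp_pos (-1 : ℝ)]

/-- `exp(−m) ≤ e^{−t}/2` once `m ≥ t + 1`. -/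
private theorem exp_neg_le_half_exp_neg {m t : ℝ} (h : t + 1 ≤ m) :
    Real.exp (-m) ≤ Real.exp (-t) / 2 := by
  have h1 : Real.exp (-m) ≤ Real.exp (-(t + 1)) := Real.exp_le_exp.mpr (by linarith)
  have h2 : Real.exp (-(t + 1)) = Real.exp (-t) * Real.exp (-1) := by
    rw [← Real.exp_add]; ring_nf
  have h4 : 0 < Real.exp (-t) := Real.exp_pos _
  calc Real.exp (-m) ≤ Real.exp (-t) * Real.exp (-1) := h1.trans_eq h2
    _ ≤ Real.exp (-t) * (1 / 2) := mul_le_mul_of_nonneg_left exp_neg_one_le_half h4.le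
    _ = Real.exp (-t) / 2 := by ring

/-- `exp(−⌈1/δ⌉) < δ` for `δ > 0`. -/
private theorem exp_neg_ceil_lt {δ : ℝ} (hδ : 0 < δ) : Real.exp (-(⌈1 / δ⌉₊ : ℝ)) < δ := by
  set M : ℝ := (⌈1 / δ⌉₊ : ℝ)
  have hM : 1 / δ ≤ M := Nat.le_ceil _
  have h3 : M + 1 ≤ Real.exp M := Real.add_one_le_exp _
  have h4 : 1 / δ < Real.exp M := by linarith
  have h5 : 1 < δ * Real.exp M := by
    have h := mul_lt_mul_of_pos_left h4 hδ
    rwa [mul_one_div_cancel hδ.ne'] at h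
  have h6 : Real.exp (-M) * Real.exp M = 1 := by
    rw [← Real.exp_add, neg_add_cancel, Real.exp_zero]
  by_contra hle
  rw [not_lt] at hle
  have h7 := mul_le_mul_of_nonneg_right hle (Real.exp_pos M).le
  linarith

/-- The exponent comparison at the end of the one-logarithm bridge. -/
private theorem three_mul_exp_le {A m K L : ℝ} (hL : 1 ≤ L) (hA : 0 ≤ A) (h : A + 3 ≤ m - K) :
    3 * Real.exp A * Real.exp (-(m * L)) ≤ Real.exp (-(K * L)) := by
  have h3 : (3 : ℝ) ≤ Real.exp 2 := by linarith [Real.add_one_le_exp (2 : ℝ)]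
  have hexp : 2 + A + -(m * L) ≤ -(K * L) := by nlinarith
  calc 3 * Real.exp A * Real.exp (-(m * L)) ≤ Real.exp 2 * Real.exp A * Real.exp (-(m * L)) := by
        gcongr
    _ = Real.exp (2 + A + -(m * L)) := by rw [Real.exp_add, Real.exp_add]
    _ ≤ Real.exp (-(K * L)) := Real.exp_le_exp.mpr hexp

/-- **The one-logarithm form ALSO forbids polynomial-quality approximations of `(u, e^u)`**
whenever `e^u ≠ 1`: the logarithm `λ_m` of the approximant `α_m` chosen next to `u` is non-zero
once `exp(−m) < ‖e^u − 1‖`, has `‖λ_m‖ ≤ ‖u‖ + 1`, and `‖λ_m − β_m‖ < 3 e^{‖u‖} q^{−m}` against the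
measure `q^{−κ''}`. -/
theorem not_liouvillePairApprox_of_logMeasure (hLM : SumFormLogMeasure) {u : ℂ}
    (hu1 : cexp u ≠ 1) : ¬ LiouvillePairApprox u := by
  rintro ⟨N₀, c, h⟩
  obtain ⟨κ, hκ⟩ := hLM (‖u‖ + 1) N₀
  set c' : ℝ := max c 1 with hc'
  have hc'1 : 1 ≤ c' := le_max_right _ _
  have hcc' : c ≤ c' := le_max_left _ _
  set κ' : ℝ := max κ 0 with hκ'
  have hκ'0 : 0 ≤ κ' := le_max_right _ _
  have hκκ' : κ ≤ κ' := le_max_left _ _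
  -- the gap `δ = ‖e^u − 1‖ > 0` and the index `m`
  have hδ0 : 0 < ‖cexp u - 1‖ := norm_pos_iff.mpr (sub_ne_zero.mpr hu1)
  have hu0 : (0 : ℝ) ≤ ‖u‖ := norm_nonneg u
  obtain ⟨m, hm3, hmA, hmB, hmC⟩ : ∃ m : ℕ, 3 ≤ m ∧ ‖u‖ + 1 ≤ (m : ℝ) ∧
      (⌈1 / ‖cexp u - 1‖⌉₊ : ℝ) ≤ (m : ℝ) ∧ ‖u‖ + 3 ≤ (m : ℝ) - κ' * (1 + c') := by
    refine ⟨⌈κ' * (1 + c')⌉₊ + ⌈‖u‖⌉₊ + ⌈1 / ‖cexp u - 1‖⌉₊ + 3, Nat.le_add_left 3 _, ?_, ?_, ?_⟩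
    all_goals
      push_cast
      linarith [Nat.le_ceil (κ' * (1 + c')), Nat.le_ceil ‖u‖,
        (Nat.cast_nonneg _ : (0 : ℝ) ≤ ⌈1 / ‖cexp u - 1‖⌉₊),
        (Nat.cast_nonneg _ : (0 : ℝ) ≤ ⌈κ' * (1 + c')⌉₊), (Nat.cast_nonneg _ : (0 : ℝ) ≤ ⌈‖u‖⌉₊)]
  obtain ⟨q, hmq, f, S, α, β, hfirr, hfdeg, hS0, hβf, hαS, hα0, hβ0, hdeg, hMS, hMf, hdist⟩ := h m
  have hq3 : (3 : ℝ) ≤ q := by exact_mod_cast (le_trans hm3 hmq : 3 ≤ q)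
  have hlog1 : 1 ≤ Real.log q := one_le_log_of_three_le hq3
  have hlog0 : 0 ≤ Real.log q := by linarith
  -- `ε := exp(−m log q) ≤ exp(−m)`, hence `ε ≤ e^{−‖u‖}/2` and `ε < ‖e^u − 1‖`
  have hm0 : (0 : ℝ) ≤ m := Nat.cast_nonneg _
  have hεm : Real.exp (-((m : ℝ) * Real.log q)) ≤ Real.exp (-(m : ℝ)) := by
    rw [Real.exp_le_exp, neg_le_neg_iff]
    have h1 := mul_le_mul_of_nonneg_left hlog1 hm0
    linarith
  have hε2 : Real.exp (-((m : ℝ) * Real.log q)) ≤ Real.exp (-‖u‖) / 2 :=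
    hεm.trans (exp_neg_le_half_exp_neg hmA)
  have hεδ : Real.exp (-((m : ℝ) * Real.log q)) < ‖cexp u - 1‖ := by
    refine hεm.trans_lt (lt_of_le_of_lt (Real.exp_le_exp.mpr ?_) (exp_neg_ceil_lt hδ0))
    linarith
  -- the two distances
  have hd1 : ‖cexp u - α‖ < Real.exp (-((m : ℝ) * Real.log q)) := by
    linarith [norm_nonneg (u - β)]
  have hd2 : ‖u - β‖ < Real.exp (-((m : ℝ) * Real.log q)) := by
    linarith [norm_nonneg (cexp u - α)]
  -- the logarithm next to `u`
  obtain ⟨lam, hlamexp, hlamu, hlam0⟩ := exists_log_near (le_refl ‖u‖) (hd1.le.trans hε2)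
  have hlamne : lam ≠ 0 := by
    intro h0
    have hα1 : α = 1 := hlam0 h0
    rw [hα1] at hd1
    exact lt_irrefl _ (hd1.trans hεδ)
  have hone : Real.exp ‖u‖ * Real.exp (-‖u‖) = 1 := by
    rw [← Real.exp_add, add_neg_cancel, Real.exp_zero]
  have he0 : 0 ≤ Real.exp ‖u‖ := (Real.exp_pos _).le
  have hlamu1 : ‖lam - u‖ ≤ 1 := by
    have h1 : 3 / 2 * Real.exp ‖u‖ * ‖cexp u - α‖ ≤ 3 / 2 * Real.exp ‖u‖ * (Real.exp (-‖u‖) / 2) :=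
      mul_le_mul_of_nonneg_left (hd1.le.trans hε2) (by positivity)
    have h2 : 3 / 2 * Real.exp ‖u‖ * (Real.exp (-‖u‖) / 2) = 3 / 4 := by
      linear_combination (3 / 4 : ℝ) * hone
    linarith [hlamu]
  have hlamT : ‖lam‖ ≤ ‖u‖ + 1 := by
    calc ‖lam‖ = ‖(lam - u) + u‖ := by rw [sub_add_cancel]
      _ ≤ ‖lam - u‖ + ‖u‖ := norm_add_le _ _
      _ ≤ ‖u‖ + 1 := by linarith
  -- height data and the one-logarithm measure
  obtain ⟨hαalg, hβalg, hD1, hDle, hhα, hhβ⟩ := pair_bounds f hfirr hfdeg hβf S hS0 hαS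
  set L : ℝ := 1 + c' * Real.log q with hLdef
  have hcL0 : 0 ≤ c' * Real.log q := mul_nonneg (by linarith) hlog0
  have hL1 : 1 ≤ L := by linarith
  have hcl : c * Real.log q ≤ c' * Real.log q := mul_le_mul_of_nonneg_right hcc' hlog0
  have hdata : AlgPairData α β N₀ L :=
    ⟨hα0, hβ0, hαalg, hβalg, hDle.trans hdeg, hL1, by linarith, by linarith⟩
  have hlow := hκ lam α β L hlamT hlamne hlamexp hdata
  -- upper bound `‖λ − β‖ < 3 e^{‖u‖} ε`
  have hup : ‖lam - β‖ < 3 * Real.exp ‖u‖ * Real.exp (-((m : ℝ) * Real.log q)) := by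
    have he1 : 1 ≤ Real.exp ‖u‖ := Real.one_le_exp hu0
    have h1 : ‖lam - β‖ ≤ ‖lam - u‖ + ‖u - β‖ := by
      calc ‖lam - β‖ = ‖(lam - u) + (u - β)‖ := by rw [sub_add_sub_cancel]
        _ ≤ ‖lam - u‖ + ‖u - β‖ := norm_add_le _ _
    have h2 : ‖lam - u‖ ≤ 3 / 2 * Real.exp ‖u‖ * Real.exp (-((m : ℝ) * Real.log q)) :=
      hlamu.trans (mul_le_mul_of_nonneg_left hd1.le (by positivity))
    have h3 : Real.exp (-((m : ℝ) * Real.log q)) ≤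
        Real.exp ‖u‖ * Real.exp (-((m : ℝ) * Real.log q)) :=
      le_mul_of_one_le_left (Real.exp_pos _).le he1
    linarith [Real.exp_pos (-((m : ℝ) * Real.log q))]
  -- lower bound from the measure, and the comparison of exponents
  have hκL : κ * L ≤ κ' * (1 + c') * Real.log q := by
    have h1 : κ * L ≤ κ' * L := mul_le_mul_of_nonneg_right hκκ' (by linarith)
    have h2 : L ≤ (1 + c') * Real.log q := by rw [hLdef]; nlinarith
    calc κ * L ≤ κ' * L := h1
      _ ≤ κ' * ((1 + c') * Real.log q) := mul_le_mul_of_nonneg_left h2 hκ'0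
      _ = κ' * (1 + c') * Real.log q := by ring
  have hlow' : Real.exp (-(κ' * (1 + c') * Real.log q)) ≤ ‖lam - β‖ :=
    le_trans (Real.exp_le_exp.mpr (neg_le_neg hκL)) hlow
  have hfin : 3 * Real.exp ‖u‖ * Real.exp (-((m : ℝ) * Real.log q)) ≤
      Real.exp (-(κ' * (1 + c') * Real.log q)) := three_mul_exp_le hlog1 hu0 hmC
  linarith [hup, hlow', hfin]

/-- **FLAGSHIP from the one-logarithm form**: `ℓ`, `e^ℓ` algebraically independent for every
Liouville real `ℓ` (here `e^ℓ ≠ 1` because `ℓ ≠ 0` is real). -/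
theorem algebraicIndependent_exp_of_liouville_log (hLM : SumFormLogMeasure) {ℓ : ℝ}
    (hℓ : Liouville ℓ) : AlgebraicIndependent ℚ ![(ℓ : ℂ), cexp ℓ] := by
  by_contra hdep
  have hℓ0 : ℓ ≠ 0 := hℓ.irrational.ne_zero
  have h1 : cexp (ℓ : ℂ) ≠ 1 := by
    rw [← Complex.ofReal_exp, ne_eq, Complex.ofReal_eq_one]
    exact fun h => hℓ0 (by simpa using h)
  exact not_liouvillePairApprox_of_logMeasure hLM h1 (liouvillePairApprox_of_dependent hℓ hdep)

/-- **The named cell from the one-logarithm form**: Schanuel's bound at `(ℓ_b, ℓ_b²)`, `b ≥ 2`. -/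
theorem liouvilleNumber_sq_cell_of_logMeasure (hLM : SumFormLogMeasure) {b : ℕ} (hb : 2 ≤ b) :
    SB 2 ![((liouvilleNumber b : ℝ) : ℂ), ((liouvilleNumber b : ℝ) : ℂ) ^ 2] :=
  sb_liouvilleNumber_sq_of_algebraicIndependent
    (algebraicIndependent_exp_of_liouville_log hLM (liouville_liouvilleNumber hb))

/-- **The two typed inputs side by side**: the pair form implies the one-logarithm form, and EACH
decides the named cell; so the weaker one-logarithm form is what the line actually needs. -/
theorem namedCell_inputs {b : ℕ} (hb : 2 ≤ b) :
    (SumFormExpPairMeasure → SumFormLogMeasure) ∧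
      (SumFormLogMeasure →
        SB 2 ![((liouvilleNumber b : ℝ) : ℂ), ((liouvilleNumber b : ℝ) : ℂ) ^ 2]) ∧
      (SumFormLogMeasure → ∀ ℓ : ℝ, Liouville ℓ → AlgebraicIndependent ℚ ![(ℓ : ℂ), cexp ℓ]) :=
  ⟨logMeasure_of_sumForm, fun h => liouvilleNumber_sq_cell_of_logMeasure h hb,
    fun h _ hℓ => algebraicIndependent_exp_of_liouville_log h hℓ⟩

/-! ## §8  Typing requirements (critic K-R27′ (3)): the MINIMAL pointwise-in-`u` shape the bridge uses, and the graded axis -/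

/-- **Pointwise sum form AT a fixed `u`** — the minimal quantifier shape the bridge actually uses:
`∀ N, ∃ κ = κ(u, N), ∀ (α, β, L), AlgPairData α β N L → exp(−κL) ≤ |e^u − α| + |u − β|` (the
constant comes AFTER `u` and `N`; no uniformity in `u`).  CONJECTURE-grade for `u ≠ 0` (a `def`). -/
def SumFormExpPairMeasureAt (u : ℂ) : Prop :=
  ∀ N : ℕ, ∃ κ : ℝ, ∀ (α β : ℂ) (L : ℝ), AlgPairData α β N L →
    Real.exp (-(κ * L)) ≤ ‖cexp u - α‖ + ‖u - β‖

/-- Uniform (`‖u‖ ≤ T`, the shape of NW96 Thm 1) ⟹ pointwise. -/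
theorem sumFormAt_of_sumForm (hSF : SumFormExpPairMeasure) {u : ℂ} (hu0 : u ≠ 0) :
    SumFormExpPairMeasureAt u := fun N => by
  obtain ⟨κ, hκ⟩ := hSF ‖u‖ N
  exact ⟨κ, fun α β L hd => hκ u α β L le_rfl hu0 hd⟩

/-- **The pointwise sum form at `u` already forbids polynomial-quality approximations of `(u, e^u)`.** -/
theorem not_liouvillePairApprox_of_sumFormAt {u : ℂ} (hSF : SumFormExpPairMeasureAt u) :
    ¬ LiouvillePairApprox u := by
  rintro ⟨N₀, c, h⟩
  obtain ⟨κ, hκ⟩ := hSF N₀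
  set c' : ℝ := max c 1 with hc'
  have hc'1 : 1 ≤ c' := le_max_right _ _
  have hcc' : c ≤ c' := le_max_left _ _
  set κ' : ℝ := max κ 0 with hκ'
  have hκ'0 : 0 ≤ κ' := le_max_right _ _
  have hκκ' : κ ≤ κ' := le_max_left _ _
  obtain ⟨q, hmq, f, S, α, β, hfirr, hfdeg, hS0, hβf, hαS, hα0, hβ0, hdeg, hMS, hMf, hdist⟩ :=
    h (⌈κ' * (1 + c')⌉₊ + 3)
  have hq3 : (3 : ℝ) ≤ q := by exact_mod_cast (le_trans (by omega) hmq : 3 ≤ q)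
  have hlog1 : 1 ≤ Real.log q := one_le_log_of_three_le hq3
  have hlog0 : 0 ≤ Real.log q := by linarith
  obtain ⟨hαalg, hβalg, hD1, hDle, hhα, hhβ⟩ := pair_bounds f hfirr hfdeg hβf S hS0 hαS
  set L : ℝ := 1 + c' * Real.log q with hLdef
  have hcL0 : 0 ≤ c' * Real.log q := mul_nonneg (by linarith) hlog0
  have hL1 : 1 ≤ L := by linarith
  have hcl : c * Real.log q ≤ c' * Real.log q := mul_le_mul_of_nonneg_right hcc' hlog0
  have hdata : AlgPairData α β N₀ L :=
    ⟨hα0, hβ0, hαalg, hβalg, hDle.trans hdeg, hL1, by linarith, by linarith⟩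
  have hlow := hκ α β L hdata
  have hκL : κ * L ≤ κ' * (1 + c') * Real.log q := by
    have h1 : κ * L ≤ κ' * L := mul_le_mul_of_nonneg_right hκκ' (by linarith)
    have h2 : L ≤ (1 + c') * Real.log q := by rw [hLdef]; nlinarith
    calc κ * L ≤ κ' * L := h1
      _ ≤ κ' * ((1 + c') * Real.log q) := mul_le_mul_of_nonneg_left h2 hκ'0
      _ = κ' * (1 + c') * Real.log q := by ring
  have hlow' : Real.exp (-(κ' * (1 + c') * Real.log q)) ≤ ‖cexp u - α‖ + ‖u - β‖ :=
    le_trans (Real.exp_le_exp.mpr (neg_le_neg hκL)) hlow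
  have hup : Real.exp (-(((⌈κ' * (1 + c')⌉₊ + 3 : ℕ) : ℝ) * Real.log q)) ≤
      Real.exp (-(κ' * (1 + c') * Real.log q)) := by
    rw [Real.exp_le_exp, neg_le_neg_iff]
    refine mul_le_mul_of_nonneg_right ?_ hlog0
    push_cast
    linarith [Nat.le_ceil (κ' * (1 + c'))]
  linarith [hdist.trans_le hup]

/-- **FLAGSHIP from the pointwise form at `u = ℓ` only.** -/
theorem algebraicIndependent_exp_of_liouville_at {ℓ : ℝ} (hSF : SumFormExpPairMeasureAt (ℓ : ℂ))
    (hℓ : Liouville ℓ) : AlgebraicIndependent ℚ ![(ℓ : ℂ), cexp ℓ] := by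
  by_contra hdep
  exact not_liouvillePairApprox_of_sumFormAt hSF (liouvillePairApprox_of_dependent hℓ hdep)

/-- **The named cell from the pointwise form at the single point `u = ℓ_b`.** -/
theorem liouvilleNumber_sq_cell_of_sumFormAt {b : ℕ} (hb : 2 ≤ b)
    (hSF : SumFormExpPairMeasureAt ((liouvilleNumber b : ℝ) : ℂ)) :
    SB 2 ![((liouvilleNumber b : ℝ) : ℂ), ((liouvilleNumber b : ℝ) : ℂ) ^ 2] :=
  sb_liouvilleNumber_sq_of_algebraicIndependent
    (algebraicIndependent_exp_of_liouville_at hSF (liouville_liouvilleNumber hb))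

/-- **THE GRADED AXIS** (lens 1): exponent `κ(T,N) · L · g(L)` in the log-height scale `L`.
`g ≡ 1` is the sum form, `g = id` the product form (NW96); every `g` in between is a rung. -/
def GradedExpPairMeasure (g : ℝ → ℝ) : Prop :=
  ∀ (T : ℝ) (N : ℕ), ∃ κ : ℝ, ∀ (u α β : ℂ) (L : ℝ), ‖u‖ ≤ T → u ≠ 0 → AlgPairData α β N L →
    Real.exp (-(κ * L * g L)) ≤ ‖cexp u - α‖ + ‖u - β‖

/-- Rung `g ≡ 1` IS the sum form. -/
theorem graded_one_iff : GradedExpPairMeasure (fun _ => 1) ↔ SumFormExpPairMeasure := by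
  simp only [GradedExpPairMeasure, SumFormExpPairMeasure, mul_one]

/-- Rung `g = id` IS the product form (the theorem modulo NW96 Thm 1). -/
theorem graded_id_iff : GradedExpPairMeasure id ↔ ProductFormExpPairMeasure := by
  simp only [GradedExpPairMeasure, ProductFormExpPairMeasure, id_eq, pow_two, mul_assoc]

/-- The axis is monotone: a smaller exponent function is a stronger statement. -/
theorem graded_mono {g₁ g₂ : ℝ → ℝ} (h12 : ∀ L, 1 ≤ L → g₁ L ≤ g₂ L)
    (h1 : ∀ L, 1 ≤ L → 0 ≤ g₁ L) : GradedExpPairMeasure g₁ → GradedExpPairMeasure g₂ := by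
  intro h T N
  obtain ⟨κ, hκ⟩ := h T N
  refine ⟨max κ 0, fun u α β L hT hu0 hd => ?_⟩
  have hL1 : 1 ≤ L := hd.2.2.2.2.2.1
  have hL0 : 0 ≤ L := by linarith
  have hlow := hκ u α β L hT hu0 hd
  refine le_trans (Real.exp_le_exp.mpr ?_) hlow
  have hg1 := h1 L hL1
  have hg12 := h12 L hL1
  have a1 : κ * L * g₁ L ≤ max κ 0 * L * g₁ L :=
    mul_le_mul_of_nonneg_right (mul_le_mul_of_nonneg_right (le_max_left κ 0) hL0) hg1
  have a2 : max κ 0 * L * g₁ L ≤ max κ 0 * L * g₂ L :=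
    mul_le_mul_of_nonneg_left hg12 (mul_nonneg (le_max_right κ 0) hL0)
  linarith

/-- Every BOUNDED rung is as good as the sum form (so «sum form» = «bounded `g`» on the axis). -/
theorem sumForm_of_graded_bounded {g : ℝ → ℝ} {G : ℝ} (hG : ∀ L, 1 ≤ L → g L ≤ G)
    (h0 : ∀ L, 1 ≤ L → 0 ≤ g L) (h : GradedExpPairMeasure g) : SumFormExpPairMeasure := by
  have h' : GradedExpPairMeasure (fun _ => G) := graded_mono hG h0 h
  intro T N
  obtain ⟨κ, hκ⟩ := h' T N
  refine ⟨κ * G, fun u α β L hT hu0 hd => ?_⟩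
  have h1 := hκ u α β L hT hu0 hd
  rwa [show κ * L * G = κ * G * L by ring] at h1

/-- Every rung with `g(L) ≤ L` implies the product form (the proved end of the axis). -/
theorem productForm_of_graded_le_id {g : ℝ → ℝ} (hg : ∀ L, 1 ≤ L → g L ≤ L)
    (h0 : ∀ L, 1 ≤ L → 0 ≤ g L) (h : GradedExpPairMeasure g) : ProductFormExpPairMeasure :=
  graded_id_iff.mp (graded_mono hg h0 h)

/-- **The axis at the named cell**, kernel-visible: the `id` rung is a THEOREM mod NW96, every
bounded rung decides `(ℓ_b, ℓ_b²)`; which UNBOUNDED rungs decide it is the rung table of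
NODE-g41.md §3 (threshold `g(L) = o(log L / log log L)` along `L ≍ k!·log b`; not typed here —
the polynomial engine of §3 only consumes bounded `g`). -/
theorem namedCell_axis {b : ℕ} (hb : 2 ≤ b) :
    (NesterenkoWaldschmidt1996_thm_1 → GradedExpPairMeasure id) ∧
      (∀ (g : ℝ → ℝ) (G : ℝ), (∀ L, 1 ≤ L → g L ≤ G) → (∀ L, 1 ≤ L → 0 ≤ g L) →
        GradedExpPairMeasure g →
          SB 2 ![((liouvilleNumber b : ℝ) : ℂ), ((liouvilleNumber b : ℝ) : ℂ) ^ 2]) :=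
  ⟨fun hNW => graded_id_iff.mpr (productForm_of_NW hNW),
    fun _ _ hG h0 h => liouvilleNumber_sq_cell_of_sumForm (sumForm_of_graded_bounded hG h0 h) hb⟩

end Summit.Schanuel.Schanuel.Theorems.RootDecomp1KSumFormBridge

end
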